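import Literature.Probability.Percolation.Chaining
import Literature.Probability.Percolation.Symmetries
import HarnessLib

/-!
# Box crossings of isoradial square lattices: the iteration of Corollary 6.2 — I. Tools

Grimmett–Manolescu, *Bond percolation on isoradial graphs* (PTRF 159 (2014) 273–327 =
arXiv:1204.0505), §6.1–§6.2: Proposition 6.1 (if `G_{α,ξ}` has the box-crossing property then so
does `G_{α,β}`), applied three times in the proof of Corollary 6.2 (`G_{0,π/2} → G_{0,β}`,
transposition, `G_{α,β₀} → G_{α,β}`). This file sets up the bookkeeping of that iteration in
index (diamond) coordinates, for the measures `P_{α,β} = prodBernoulli (gmWeight α β)`: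

* `lrEvt A B a b` / `tbEvt A B a b` — left–right / top–bottom crossings of the index box
  `[A, A+a] × [B, B+b]` (the tree's `embRectCrossing` / `embTBCrossing` for the drawing `zDia`);
  their monotonicity in the box (`lrEvt_anti_width`, `lrEvt_mono_height`, `tbEvt_anti_height`,
  `tbEvt_mono_width`; clipping on lattice configurations);
* classes of lattices as sets of pairs `(α, β)`, the transposed class `transpC`, and *uniform
  lower bounds* as sets of witnesses `lrLower C ρ`, `tbLower C ρ ⊆ ℝ × ℕ` (pairs `(c, n₀)`,
  `c > 0`, bounding the crossing probabilities of all `ρn × n` resp. `n × ρn` boxes, `n ≥ n₀`, at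
  all integer positions, for all lattices of the class);
* `tbLower_of_lrLower_transp` — transposition exchanges the two kinds of bounds;
* `lrLower_all_of_two` — **chaining** (GM14 §2.3): bounds for `2n × n` left–right and `n × 2n`
  top–bottom crossings give bounds for `ρn × n` left–right crossings, every `ρ`.

## References

* G. R. Grimmett, I. Manolescu, PTRF 159 (2014), arXiv:1204.0505, §2.3, §6.1, §6.2.
-/

noncomputable section

namespace Literature.Probability.Percolation

open LatticeModels StarTriangle Real MeasureTheory Complex

namespace TrackExchange

/-! ### Index-box crossing events -/

/-- Left–right crossing of the index box `[A, A+a] × [B, B+b]`. [cite: GrimmettManolescu2014Isoradial, §4.6 (C_h)] -/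
def lrEvt (A B : ℤ) (a b : ℕ) : Set (Set (Sym2 (Site 2))) :=
  embRectCrossing (fun v => zDia v - ((A : ℂ) + (B : ℂ) * I)) a b

/-- Top–bottom crossing of the index box `[A, A+a] × [B, B+b]`. [cite: GrimmettManolescu2014Isoradial, §4.6 (C_v)] -/
def tbEvt (A B : ℤ) (a b : ℕ) : Set (Set (Sym2 (Site 2))) :=
  embTBCrossing (fun v => zDia v - ((A : ℂ) + (B : ℂ) * I)) a b

/-- `P_{α,β}`. [cite: GrimmettManolescu2014Isoradial, §4.6] -/
abbrev Pgm (α β : ℤ → ℝ) : Measure (Set (Sym2 (Site 2))) := prodBernoulli (Percolation.gmWeight α β)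

/-- Unfolding membership in `lrEvt`. [folklore] -/
theorem mem_lrEvt_iff {A B : ℤ} {a b : ℕ} {ω : Set (Sym2 (Site 2))} :
    ω ∈ lrEvt A B a b ↔ ∃ x, (col x : ℝ) ≤ A ∧ ∃ y, (A : ℝ) + a ≤ col y ∧
      ω ∈ openConnIn {v : Site 2 | ((A : ℝ) - 2 ≤ col v ∧ (col v : ℝ) ≤ A + a + 2) ∧ (B : ℝ) ≤ hgtOf v ∧ (hgtOf v : ℝ) ≤ B + b} x y := by
  unfold lrEvt embRectCrossing openCrossing
  simp only [Set.mem_setOf_eq, re_zDia_sub_int, im_zDia_sub_int, Set.mem_Icc]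
  constructor
  · rintro ⟨x, hx, y, hy, h⟩
    refine ⟨x, by linarith, y, by linarith, ?_⟩
    convert h using 2; ext v; simp only [Set.mem_setOf_eq]; constructor <;> rintro ⟨⟨h1, h2⟩, h3, h4⟩ <;>
      exact ⟨⟨by linarith, by linarith⟩, by linarith, by linarith⟩
  · rintro ⟨x, hx, y, hy, h⟩
    refine ⟨x, by linarith, y, by linarith, ?_⟩
    convert h using 2; ext v; simp only [Set.mem_setOf_eq]; constructor <;> rintro ⟨⟨h1, h2⟩, h3, h4⟩ <;>
      exact ⟨⟨by linarith, by linarith⟩, by linarith, by linarith⟩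

/-- Unfolding membership in `tbEvt`. [folklore] -/
theorem mem_tbEvt_iff {A B : ℤ} {a b : ℕ} {ω : Set (Sym2 (Site 2))} :
    ω ∈ tbEvt A B a b ↔ ∃ x, (hgtOf x : ℝ) ≤ B ∧ ∃ y, (B : ℝ) + b ≤ hgtOf y ∧
      ω ∈ openConnIn {v : Site 2 | ((A : ℝ) ≤ col v ∧ (col v : ℝ) ≤ A + a) ∧ (B : ℝ) - 2 ≤ hgtOf v ∧ (hgtOf v : ℝ) ≤ B + b + 2} x y := by
  unfold tbEvt embTBCrossing openCrossing
  simp only [Set.mem_setOf_eq, re_zDia_sub_int, im_zDia_sub_int, Set.mem_Icc]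
  constructor
  · rintro ⟨x, hx, y, hy, h⟩
    refine ⟨x, by linarith, y, by linarith, ?_⟩
    convert h using 2; ext v; simp only [Set.mem_setOf_eq]; constructor <;> rintro ⟨⟨h1, h2⟩, h3, h4⟩ <;>
      exact ⟨⟨by linarith, by linarith⟩, by linarith, by linarith⟩
  · rintro ⟨x, hx, y, hy, h⟩
    refine ⟨x, by linarith, y, by linarith, ?_⟩
    convert h using 2; ext v; simp only [Set.mem_setOf_eq]; constructor <;> rintro ⟨⟨h1, h2⟩, h3, h4⟩ <;>
      exact ⟨⟨by linarith, by linarith⟩, by linarith, by linarith⟩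

/-! ### Monotonicity in the box -/

/-- **A left–right crossing of a wider box is one of every narrower box with the same heights**
(lattice configurations; clipping). [folklore] -/
theorem lrEvt_anti_width {A A' B : ℤ} {a a' b : ℕ} (h1 : A' ≤ A) (h2 : A + a ≤ A' + a')
    {ω : Set (Sym2 (Site 2))} (hω : ω ⊆ (zdGraph 2).edgeSet) (h : ω ∈ lrEvt A' B a' b) : ω ∈ lrEvt A B a b := by
  rw [mem_lrEvt_iff] at h ⊢
  obtain ⟨x, hx, y, hy, hconn⟩ := h
  have ix : col x ≤ A := (Int.cast_le (R := ℝ)).1 (hx.trans (Int.cast_le.2 h1))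
  have iy : A + a ≤ col y := by
    have h2' : (A : ℝ) + a ≤ (A' : ℝ) + a' := by exact_mod_cast h2
    have : ((A + a : ℤ) : ℝ) ≤ col y := by push_cast; linarith
    exact_mod_cast this
  obtain ⟨x', y', hx', hy', hconn'⟩ := exists_openConnIn_clip hω col col_le_of_adj (a := A) (b := A + a) (by omega) ix iy hconn
  refine ⟨x', le_of_eq (by rw [hx']), y', le_of_eq (by rw [hy']; push_cast; ring), openConnIn_mono (fun v hv => ?_) _ _ hconn'⟩
  obtain ⟨⟨-, h3, h4⟩, h5, h6⟩ := hv
  have i5 : ((A : ℤ) : ℝ) ≤ col v := by exact_mod_cast h5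
  have i6 : (col v : ℝ) ≤ ((A + a : ℤ) : ℝ) := by exact_mod_cast h6
  push_cast at i6
  exact ⟨⟨by linarith, by linarith⟩, h3, h4⟩

/-- **A left–right crossing within a height range is one within every larger height range.** [folklore] -/
theorem lrEvt_mono_height {A B B' : ℤ} {a b b' : ℕ} (h1 : B' ≤ B) (h2 : B + b ≤ B' + b')
    {ω : Set (Sym2 (Site 2))} (h : ω ∈ lrEvt A B a b) : ω ∈ lrEvt A B' a b' := by
  rw [mem_lrEvt_iff] at h ⊢
  obtain ⟨x, hx, y, hy, hconn⟩ := h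
  have i1 := (Int.cast_le (R := ℝ)).2 h1
  have i2 := (Int.cast_le (R := ℝ)).2 h2
  push_cast at i2
  refine ⟨x, hx, y, hy, openConnIn_mono (fun v hv => ?_) _ _ hconn⟩
  obtain ⟨h3, h5, h6⟩ := hv
  exact ⟨h3, by linarith, by linarith⟩

/-- **A top–bottom crossing of a taller box is one of every shorter box with the same columns**
(lattice configurations; clipping). [folklore] -/
theorem tbEvt_anti_height {A B B' : ℤ} {a b b' : ℕ} (h1 : B' ≤ B) (h2 : B + b ≤ B' + b')
    {ω : Set (Sym2 (Site 2))} (hω : ω ⊆ (zdGraph 2).edgeSet) (h : ω ∈ tbEvt A B' a b') : ω ∈ tbEvt A B a b := by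
  rw [mem_tbEvt_iff] at h ⊢
  obtain ⟨x, hx, y, hy, hconn⟩ := h
  have ix : hgtOf x ≤ B := (Int.cast_le (R := ℝ)).1 (hx.trans (Int.cast_le.2 h1))
  have iy : B + b ≤ hgtOf y := by
    have : ((B + b : ℤ) : ℝ) ≤ hgtOf y := by
      have := (Int.cast_le (R := ℝ)).2 h2; push_cast at this ⊢; linarith
    exact_mod_cast this
  obtain ⟨x', y', hx', hy', hconn'⟩ := exists_openConnIn_clip hω hgtOf hgtOf_le_of_adj (a := B) (b := B + b) (by omega) ix iy hconn
  refine ⟨x', le_of_eq (by rw [hx']), y', le_of_eq (by rw [hy']; push_cast; ring), openConnIn_mono (fun v hv => ?_) _ _ hconn'⟩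
  obtain ⟨⟨h3, -, -⟩, h5, h6⟩ := hv
  have i5 : ((B : ℤ) : ℝ) ≤ hgtOf v := by exact_mod_cast h5
  have i6 : (hgtOf v : ℝ) ≤ ((B + b : ℤ) : ℝ) := by exact_mod_cast h6
  push_cast at i6
  exact ⟨h3, by linarith, by linarith⟩

/-- **A top–bottom crossing within a column range is one within every larger column range.** [folklore] -/
theorem tbEvt_mono_width {A A' B : ℤ} {a a' b : ℕ} (h1 : A' ≤ A) (h2 : A + a ≤ A' + a')
    {ω : Set (Sym2 (Site 2))} (h : ω ∈ tbEvt A B a b) : ω ∈ tbEvt A' B a' b := by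
  rw [mem_tbEvt_iff] at h ⊢
  obtain ⟨x, hx, y, hy, hconn⟩ := h
  have i1 := (Int.cast_le (R := ℝ)).2 h1
  have i2 := (Int.cast_le (R := ℝ)).2 h2
  push_cast at i2
  refine ⟨x, hx, y, hy, openConnIn_mono (fun v hv => ?_) _ _ hconn⟩
  obtain ⟨⟨h3, h4⟩, h5⟩ := hv
  exact ⟨⟨by linarith, by linarith⟩, h5⟩

/-- Measurability. [folklore] -/
theorem measurableSet_lrEvt (A B : ℤ) (a b : ℕ) : MeasurableSet (lrEvt A B a b) :=
  IsoradialArmExtension.measurableSet_embRectCrossing _ _ _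

/-- Measurability. [folklore] -/
theorem measurableSet_tbEvt (A B : ℤ) (a b : ℕ) : MeasurableSet (tbEvt A B a b) :=
  IsoradialArmExtension.measurableSet_embTBCrossing _ _ _

/-- Probabilities of a.s.-comparable events compare. [folklore] -/
theorem measureReal_le_of_subset_ae (α β : ℤ → ℝ) {E F : Set (Set (Sym2 (Site 2)))}
    (h : ∀ ω, ω ⊆ (zdGraph 2).edgeSet → ω ∈ E → ω ∈ F) : (Pgm α β).real E ≤ (Pgm α β).real F := by
  rw [← measureReal_inter_subset_edgeSet α β E]
  exact measureReal_mono (fun ω hω => h ω hω.2 hω.1) (measure_ne_top _ _)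

/-! ### Classes of lattices and uniform lower bounds -/

/-- The transposed class: `(α, β) ↦ (-β, -α)`. [cite: GrimmettManolescu2014Isoradial, §6.2 (proof of Cor. 6.2)] -/
def transpC (C : Set ((ℤ → ℝ) × (ℤ → ℝ))) : Set ((ℤ → ℝ) × (ℤ → ℝ)) :=
  {p | (fun i => -p.2 i, fun j => -p.1 j) ∈ C}

/-- **Uniform lower bounds for left–right crossings of `ρn × n` boxes** over a class `C`: the set
of witnesses `(c, n₀)`. [cite: GrimmettManolescu2014Isoradial, §2.2 (box-crossing property, lower bounds)] -/
def lrLower (C : Set ((ℤ → ℝ) × (ℤ → ℝ))) (ρ : ℕ) : Set (ℝ × ℕ) :=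
  {q | 0 < q.1 ∧ ∀ p ∈ C, ∀ n : ℕ, q.2 ≤ n → ∀ A B : ℤ, q.1 ≤ (Pgm p.1 p.2).real (lrEvt A B (ρ * n) n)}

/-- **Uniform lower bounds for top–bottom crossings of `n × ρn` boxes** over a class `C`. [cite: GrimmettManolescu2014Isoradial, §2.2 (box-crossing property, lower bounds)] -/
def tbLower (C : Set ((ℤ → ℝ) × (ℤ → ℝ))) (ρ : ℕ) : Set (ℝ × ℕ) :=
  {q | 0 < q.1 ∧ ∀ p ∈ C, ∀ n : ℕ, q.2 ≤ n → ∀ A B : ℤ, q.1 ≤ (Pgm p.1 p.2).real (tbEvt A B n (ρ * n))}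

/-- Bounds pass to subclasses. [folklore] -/
theorem lrLower_mono {C C' : Set ((ℤ → ℝ) × (ℤ → ℝ))} (h : C ⊆ C') (ρ : ℕ) : lrLower C' ρ ⊆ lrLower C ρ :=
  fun _ hq => ⟨hq.1, fun p hp => hq.2 p (h hp)⟩

/-- Bounds pass to subclasses. [folklore] -/
theorem tbLower_mono {C C' : Set ((ℤ → ℝ) × (ℤ → ℝ))} (h : C ⊆ C') (ρ : ℕ) : tbLower C' ρ ⊆ tbLower C ρ :=
  fun _ hq => ⟨hq.1, fun p hp => hq.2 p (h hp)⟩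

/-- **Transposition exchanges the two kinds of bounds.** [cite: GrimmettManolescu2014Isoradial, §6.2 (proof of Cor. 6.2)] -/
theorem tbLower_of_lrLower_transp {C : Set ((ℤ → ℝ) × (ℤ → ℝ))} {ρ : ℕ} {q : ℝ × ℕ} (hq : q ∈ lrLower (transpC C) ρ) :
    q ∈ tbLower C ρ := by
  refine ⟨hq.1, fun p hp n hn A B => ?_⟩
  have key := hq.2 (fun i => -p.2 i, fun j => -p.1 j) (by simpa [transpC] using hp) n hn B A
  rw [tbEvt, measureReal_embTBCrossing_transp_int p.1 p.2 0]
  simpa [lrEvt] using key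

/-- And conversely. [cite: GrimmettManolescu2014Isoradial, §6.2 (proof of Cor. 6.2)] -/
theorem lrLower_of_tbLower_transp {C : Set ((ℤ → ℝ) × (ℤ → ℝ))} {ρ : ℕ} {q : ℝ × ℕ} (hq : q ∈ tbLower (transpC C) ρ) :
    q ∈ lrLower C ρ := by
  refine ⟨hq.1, fun p hp n hn A B => ?_⟩
  have key := hq.2 (fun i => -p.2 i, fun j => -p.1 j) (by simpa [transpC] using hp) n hn B A
  rw [lrEvt, measureReal_embRectCrossing_transp_int p.1 p.2 0]
  simpa [tbEvt] using key

/-- `transpC` is an involution. [folklore] -/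
theorem transpC_transpC (C : Set ((ℤ → ℝ) × (ℤ → ℝ))) : transpC (transpC C) = C := by
  ext p; simp [transpC]

/-! ### Chaining: all aspect ratios from aspect ratio two -/

/-- **Chaining** (GM14 §2.3): lower bounds for `2n × n` left–right and `n × 2n` top–bottom crossings
over a class give lower bounds for `ρn × n` left–right crossings, for every `ρ ≥ 1`.
[cite: GrimmettManolescu2014Isoradial, §2.3 (Harris–FKG reduction to aspect ratio 2)] -/
theorem lrLower_all_of_two {C : Set ((ℤ → ℝ) × (ℤ → ℝ))} (hH : (lrLower C 2).Nonempty) (hV : (tbLower C 2).Nonempty)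
    {ρ : ℕ} (hρ : 1 ≤ ρ) : (lrLower C ρ).Nonempty := by
  obtain ⟨⟨cH, nH⟩, hcH, hHb⟩ := hH
  obtain ⟨⟨cV, nV⟩, hcV, hVb⟩ := hV
  simp only at hcH hHb hcV hVb
  -- `ρ = 1`: a `2n × n` crossing is an `n × n` crossing
  rcases Nat.lt_or_ge ρ 2 with hρ2 | hρ2
  · have hρ1 : ρ = 1 := by omega
    subst hρ1
    refine ⟨(cH, nH), hcH, fun p hp n hn A B => (hHb p hp n hn A B).trans ?_⟩
    exact measureReal_le_of_subset_ae p.1 p.2 fun ω hω h => lrEvt_anti_width (le_refl A) (by push_cast; omega) hω h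
  -- `ρ ≥ 2`: chain `ρ - 1` pieces and `ρ - 2` connectors
  set K : ℕ := ρ - 2 with hK
  refine ⟨(cH ^ (K + 1) * cV ^ K, max (max nH nV) 1), by positivity, fun p hp n hn A B => ?_⟩
  simp only at hn ⊢
  have hnH : nH ≤ n := le_trans (le_trans (le_max_left _ _) (le_max_left _ _)) hn
  have hnV : nV ≤ n := le_trans (le_trans (le_max_right _ _) (le_max_left _ _)) hn
  have hn1 : 1 ≤ n := le_trans (le_max_right _ _) hn
  have key := prod_le_measureReal_chain (a := fun j => A + j * n) (B := B) (B' := B) (w := 2 * n) (c := n) (h := n) (h' := n)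
    p.1 p.2 (by omega) (by omega) (by omega) (fun j => by push_cast; nlinarith) (fun j => by push_cast; nlinarith) le_rfl le_rfl K
  have hw : ((A + (K : ℕ) * n : ℤ) + (2 * n : ℕ) - (A + (0 : ℕ) * n : ℤ) : ℤ) = ((ρ * n : ℕ) : ℤ) := by
    push_cast; rw [hK]; have : ((ρ - 2 : ℕ) : ℤ) = ρ - 2 := by omega
    rw [this]; ring
  simp only [Nat.cast_zero, zero_mul, add_zero] at key hw
  rw [hw] at key
  refine le_trans ?_ (key.trans (le_of_eq ?_))
  · -- the product of the bounds
    have h1 : cH ^ (K + 1) ≤ ∏ j ∈ Finset.range (K + 1), (Pgm p.1 p.2).real (hBox (fun j => A + j * n) B (2 * n) n j) := by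
      rw [← Finset.card_range (K + 1), ← Finset.prod_const, Finset.card_range]
      refine Finset.prod_le_prod (fun _ _ => hcH.le) fun j _ => ?_
      have := hHb p hp n hnH (A + j * n) B
      simpa [hBox, lrEvt] using this
    have h2 : cV ^ K ≤ ∏ j ∈ Finset.range K, (Pgm p.1 p.2).real (vBox (fun j => A + j * n) B n n j) := by
      rw [← Finset.card_range K, ← Finset.prod_const, Finset.card_range]
      refine Finset.prod_le_prod (fun _ _ => hcV.le) fun j _ => (hVb p hp n hnV (A + (j + 1 : ℕ) * n) B).trans ?_
      refine measureReal_le_of_subset_ae p.1 p.2 fun ω hω h => ?_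
      have h' : ω ∈ tbEvt (A + (j + 1 : ℕ) * n) B n n := tbEvt_anti_height (le_refl B) (by push_cast; omega) hω h
      simpa [vBox, tbEvt] using h'
    exact mul_le_mul h1 h2 (by positivity) (le_trans (by positivity) h1)
  · simp only [lrEvt]; norm_cast

end TrackExchange

end Literature.Probability.Percolation
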